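import Summits.AtomisticToContinuum.HydrodynamicLimit.Theorems.RelayRaceLocalityNearConstantShortTimeHLOrbitExpansion
import HarnessLib

/-!
# Crux `NearConstantShortTimeHL` (stmt-AtomisticToContinuum-12502), line `small-tilt-domination` — the cell estimate

Support file for the crux `…Theses.RelayRaceLocality.NearConstantShortTimeHL`, line `small-tilt-domination`
(route `route-AtomisticToContinuum-RelayRaceLocality`: Yau's relative-entropy method, discretised Grönwall over time cells),
registered stub **`cell_estimate`**.

The EXPECTATION-LEVEL CELL ESTIMATE of the discretised relative-entropy Grönwall argument. Write `s' = s + τ`,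
`m r := E_P[X_r ∘ Φ_r]`, `D := mst − m` (the entropy deficit), `J z := ∫_s^{s'} X_r (Φ_r z) dr`, `K := kineticPP`,
`IT z := ∫_s^{s'} Tl_r (Φ_r z) dr`. Then

  `∫_s^{s'} D − τ · D(s) ≤ CE τ² + 2 d + C₁ τ (τ (1 + E K) + τ C₂) + 2 CX τ · E[(1 + K); G'ᶜ]`.

Proof. Split `∫ D − τ D(s) = [∫ mst − τ mst s] + [τ m s − ∫ m]`.
* Time bracket (`xp_time_bracket`): `∫_s^{s'} mst − τ mst s = ∫_s^{s'} (mst r − mst s) dr ≤ ∫_s^{s'} CE τ = CE τ²`.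
* Expectation bracket (`xp_expect_bracket`): by the Fubini hypothesis `∫_s^{s'} m = E J`, so the bracket is `E[τ X_s ∘ Φ_s − J]`;
  pointwise, for GOOD `z` (which are `P`-almost all points, `P ≪ Liouville`): on `G'` the pathwise weighted-cell expansion gives
  `τ X_s − J ≤ 2 d + C₁ τ (τ (1 + K) + IT)`; off `G'` the crude bounds `|X_r| ≤ CX (1 + K)` and conservation of `K` along orbits
  (`wc_kineticPP_flow`, `xp_abs_intervalIntegral_le`) give `τ X_s − J ≤ 2 CX τ (1 + K)`. Integrate the majorant
  `2 d + C₁ τ (τ (1 + K) + IT) + 𝟙_{G'ᶜ} 2 CX τ (1 + K)` (nonnegative first part) and use `E IT ≤ τ C₂`.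

No definitions, no named facts. References: H.-T. Yau, Lett. Math. Phys. 22 (1991) §2 (the relative-entropy Grönwall scheme).
-/

noncomputable section

namespace Summit.AtomisticToContinuum.HydrodynamicLimit.Theorems.NearConstantShortTimeHL

open scoped BigOperators ENNReal Topology
open MeasureTheory Set Filter
open Literature.MathematicalPhysics.KineticTheory Literature.Analysis.FluidPDE Literature.Analysis.FunctionSpaces

/-- **Euler oscillation over one cell.** If `mst` is continuous on `[s, s + τ]` (`τ ≥ 0`) with
`|mst r − mst s| ≤ CE (r − s)` there (`CE ≥ 0`), then `∫_s^{s+τ} mst − τ · mst s ≤ CE τ²`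
(indeed `≤ CE τ²/2`; the crude bound suffices). [folklore] -/
theorem xp_time_bracket {s τ CE : ℝ} (hτ : 0 ≤ τ) {mst : ℝ → ℝ} (hmst : ContinuousOn mst (Set.Icc s (s + τ)))
    (hE : ∀ r ∈ Set.Icc s (s + τ), |mst r - mst s| ≤ CE * (r - s)) (hCE : 0 ≤ CE) :
    (∫ r in s..(s + τ), mst r) - τ * mst s ≤ CE * τ ^ 2 := by
  have hle : s ≤ s + τ := le_add_of_nonneg_right hτ
  have hI : IntervalIntegrable mst volume s (s + τ) := hmst.intervalIntegrable_of_Icc hle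
  have hc : IntervalIntegrable (fun _ : ℝ => mst s) volume s (s + τ) := intervalIntegrable_const
  have hc' : IntervalIntegrable (fun _ : ℝ => CE * τ) volume s (s + τ) := intervalIntegrable_const
  have h1 : (∫ r in s..(s + τ), (mst r - mst s)) = (∫ r in s..(s + τ), mst r) - τ * mst s := by
    rw [intervalIntegral.integral_sub hI hc, intervalIntegral.integral_const, add_sub_cancel_left, smul_eq_mul]
  have h2 : (∫ r in s..(s + τ), (mst r - mst s)) ≤ ∫ _ in s..(s + τ), CE * τ := by
    refine intervalIntegral.integral_mono_on hle (hI.sub hc) hc' fun r hr => ?_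
    calc mst r - mst s ≤ |mst r - mst s| := le_abs_self _
      _ ≤ CE * (r - s) := hE r hr
      _ ≤ CE * τ := mul_le_mul_of_nonneg_left (by linarith [hr.2]) hCE
  have h3 : (∫ _ in s..(s + τ), CE * τ) = CE * τ ^ 2 := by
    rw [intervalIntegral.integral_const, add_sub_cancel_left, smul_eq_mul]
    ring
  linarith

/-- **Crude bound on a time integral.** If `|f r| ≤ c` on `[s, s + τ]` (`τ ≥ 0`) then `|∫_s^{s+τ} f| ≤ τ c`
(no integrability needed: the junk value `0` obeys the bound too). [folklore] -/
theorem xp_abs_intervalIntegral_le {s τ c : ℝ} (hτ : 0 ≤ τ) {f : ℝ → ℝ}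
    (hf : ∀ r ∈ Set.Icc s (s + τ), |f r| ≤ c) : |∫ r in s..(s + τ), f r| ≤ τ * c := by
  have hle : s ≤ s + τ := le_add_of_nonneg_right hτ
  have h := intervalIntegral.norm_integral_le_of_norm_le_const (a := s) (b := s + τ) (C := c) (f := f)
    (fun r hr => by
      rw [Real.norm_eq_abs]
      rw [Set.uIoc_of_le hle] at hr
      exact hf r (Ioc_subset_Icc_self hr))
  rw [Real.norm_eq_abs, add_sub_cancel_left, abs_of_nonneg hτ] at h
  exact h.trans_eq (mul_comm _ _)

/-- **Expectation bracket of the cell estimate** (abstract form). On a probability space with an almost sure event `good`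
and a measurable event `G'`: if on `G' ∩ good` `|J − τ Xs − wM − wE| ≤ C₁ τ (τ (1 + K) + IT)` with `|wM|, |wE| ≤ d`, on `good`
`|J| ≤ τ CX (1 + K)` and `|Xs| ≤ CX (1 + K)`, `K ≥ 0`, `IT ≥ 0` on `good`, everything integrable and `E IT ≤ τ C₂`, then
`τ E Xs − E J ≤ 2 d + C₁ τ (τ (1 + E K) + τ C₂) + 2 CX τ E[(1 + K); G'ᶜ]`. [folklore] -/
theorem xp_expect_bracket {Ω : Type*} [MeasurableSpace Ω] {P : Measure Ω} [IsProbabilityMeasure P]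
    {good G' : Set Ω} (hgood : ∀ᵐ z ∂P, z ∈ good) (hG' : MeasurableSet G')
    {J Xs K IT wM wE : Ω → ℝ} {τ C₁ C₂ CX d : ℝ} (hτ : 0 ≤ τ) (hC₁ : 0 ≤ C₁) (hd : 0 ≤ d)
    (hpath : ∀ z ∈ G', z ∈ good →
      |J z - τ * Xs z - wM z - wE z| ≤ C₁ * τ * (τ * (1 + K z) + IT z) ∧ |wM z| ≤ d ∧ |wE z| ≤ d)
    (hJb : ∀ z ∈ good, |J z| ≤ τ * (CX * (1 + K z))) (hXs : ∀ z ∈ good, |Xs z| ≤ CX * (1 + K z))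
    (hK : ∀ z, 0 ≤ K z) (hIT : ∀ z ∈ good, 0 ≤ IT z)
    (hJint : Integrable J P) (hXsint : Integrable Xs P) (hKint : Integrable K P) (hITint : Integrable IT P)
    (hITle : ∫ z, IT z ∂P ≤ τ * C₂) :
    τ * (∫ z, Xs z ∂P) - ∫ z, J z ∂P ≤
      2 * d + C₁ * τ * (τ * (1 + ∫ z, K z ∂P) + τ * C₂) + 2 * CX * τ * (∫ z in G'ᶜ, (1 + K z) ∂P) := by
  -- the integrable majorant `B = B₁ + 𝟙_{G'ᶜ} B₂`
  have h1K : Integrable (fun z => 1 + K z) P := (integrable_const 1).add hKint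
  have hR : Integrable (fun z => C₁ * τ * (τ * (1 + K z) + IT z)) P := ((h1K.const_mul τ).add hITint).const_mul _
  have hB1 : Integrable (fun z => 2 * d + C₁ * τ * (τ * (1 + K z) + IT z)) P := (integrable_const _).add hR
  have hB2 : Integrable (fun z => G'ᶜ.indicator (fun z => 2 * CX * τ * (1 + K z)) z) P :=
    (h1K.const_mul _).indicator hG'.compl
  -- the pointwise bound, almost surely
  have hle : ∀ᵐ z ∂P, τ * Xs z - J z ≤
      (2 * d + C₁ * τ * (τ * (1 + K z) + IT z)) + G'ᶜ.indicator (fun z => 2 * CX * τ * (1 + K z)) z := by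
    filter_upwards [hgood] with z hz
    have hKz := hK z
    have hITz := hIT z hz
    by_cases hzG : z ∈ G'
    · obtain ⟨h1, h2, h3⟩ := hpath z hzG hz
      rw [Set.indicator_of_notMem (Set.notMem_compl_iff.2 hzG), add_zero]
      linarith [neg_le_abs (J z - τ * Xs z - wM z - wE z), neg_le_abs (wM z), neg_le_abs (wE z)]
    · rw [Set.indicator_of_mem (Set.mem_compl hzG)]
      have hX : τ * Xs z ≤ τ * (CX * (1 + K z)) :=
        mul_le_mul_of_nonneg_left ((le_abs_self _).trans (hXs z hz)) hτ
      have hR0 : 0 ≤ C₁ * τ * (τ * (1 + K z) + IT z) := by positivity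
      linarith [neg_le_abs (J z), hJb z hz]
  -- integrate
  have hint : τ * (∫ z, Xs z ∂P) - ∫ z, J z ∂P = ∫ z, (τ * Xs z - J z) ∂P := by
    rw [integral_sub (hXsint.const_mul τ) hJint, integral_const_mul]
  have hmono : ∫ z, (τ * Xs z - J z) ∂P ≤
      ∫ z, ((2 * d + C₁ * τ * (τ * (1 + K z) + IT z)) + G'ᶜ.indicator (fun z => 2 * CX * τ * (1 + K z)) z) ∂P :=
    integral_mono_ae ((hXsint.const_mul τ).sub hJint) (hB1.add hB2) hle
  have e1 : ∫ z, (2 * d + C₁ * τ * (τ * (1 + K z) + IT z)) ∂P =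
      2 * d + C₁ * τ * (τ * (1 + ∫ z, K z ∂P) + ∫ z, IT z ∂P) := by
    rw [integral_add (integrable_const _) hR, integral_const, probReal_univ, one_smul, integral_const_mul,
      integral_add (h1K.const_mul τ) hITint, integral_const_mul, integral_add (integrable_const _) hKint,
      integral_const, probReal_univ, one_smul]
  have e2 : ∫ z, G'ᶜ.indicator (fun z => 2 * CX * τ * (1 + K z)) z ∂P = 2 * CX * τ * ∫ z in G'ᶜ, (1 + K z) ∂P := by
    rw [integral_indicator hG'.compl, integral_const_mul]
  have e3 := integral_add hB1 hB2
  have hC : C₁ * τ * (τ * (1 + ∫ z, K z ∂P) + ∫ z, IT z ∂P) ≤ C₁ * τ * (τ * (1 + ∫ z, K z ∂P) + τ * C₂) :=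
    mul_le_mul_of_nonneg_left (by linarith) (mul_nonneg hC₁ hτ)
  linarith

/-- **The cell estimate** (registered stub of line `small-tilt-domination`, step 3b-ii of the discretised relative-entropy
Grönwall): for a hard-sphere flow `Φ` on `𝕋³`, a law `P ≪ Liouville`, an observable `X_r` with `|X_r| ≤ CX (1 + K)` on the cell
`[s, s + τ]`, a continuous `mst` with `|mst r − mst s| ≤ CE (r − s)`, and the pathwise weighted-cell expansion
`|∫_s^{s+τ} X_r ∘ Φ_r − τ X_s ∘ Φ_s − wM − wE| ≤ C₁ τ (τ (1 + K) + ∫ Tl)` with `|wM|, |wE| ≤ d` on a good event `G'`,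
the deficit `D = mst − E_P[X ∘ Φ]` satisfies
`∫_s^{s+τ} D − τ D(s) ≤ CE τ² + 2 d + C₁ τ (τ (1 + E K) + τ C₂) + 2 CX τ E[(1 + K); G'ᶜ]`.
Proof: `xp_time_bracket` + `xp_expect_bracket` (good points are `P`-almost all points; `K` is conserved along orbits).
[cite: Yau1991, §2] -/
theorem cell_estimate : ∀ {ε : ℝ} {n : ℕ} (Φ : HardSphereFlow (Torus.geometry (Fin 3)) ε n) (P : Measure (Config n (Fin 3) T3)) [IsProbabilityMeasure P], P ≪ liouville (Torus.geometry (Fin 3)) n ε → ∀ {s τ : ℝ}, 0 < τ → ∀ (X : ℝ → Config n (Fin 3) T3 → ℝ) (mst : ℝ → ℝ) (Tl : ℝ → Config n (Fin 3) T3 → ℝ) (wM wE : Config n (Fin 3) T3 → ℝ) (G' : Set (Config n (Fin 3) T3)), MeasurableSet G' → ∀ {C₁ C₂ CX CE d : ℝ}, 0 ≤ C₁ → 0 ≤ C₂ → 0 ≤ CX → 0 ≤ CE → 0 ≤ d → (∀ z ∈ G', z ∈ Φ.good → |(∫ r in s..(s + τ), X r (Φ.flow r z)) - τ * X s (Φ.flow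 s z) - wM z - wE z| ≤ C₁ * τ * (τ * (1 + kineticPP z) + ∫ r in s..(s + τ), Tl r (Φ.flow r z)) ∧ |wM z| ≤ d ∧ |wE z| ≤ d) → (∀ r ∈ Set.Icc s (s + τ), ∀ w : Config n (Fin 3) T3, |X r w| ≤ CX * (1 + kineticPP w)) → ContinuousOn mst (Set.Icc s (s + τ)) → (∀ r ∈ Set.Icc s (s + τ), |mst r - mst s| ≤ CE * (r - s)) → (∀ r, ∀ w : Config n (Fin 3) T3, 0 ≤ Tl r w) → (∀ r ∈ Set.Icc s (s + τ), Integrable (fun z => X r (Φ.flow r z)) P) → Integrable (fun z => kineticPP z) P → Integrable (fun z => ∫ r in s..(s + τ), X r (Φ.flow r z)) P → (∫ z, (∫ r in s..(s + τ), X r (Φ.flow r z)) ∂P) = ∫ r in s..(s + τ), ∫ z, X r (Φ.flow r z) ∂P → IntervalIntegrable (fun r => ∫ z, X r (Φ.flow r z) ∂P) volume s (s + τ) → Integrable (fun z => ∫ r in s..(s + τ), Tl r (Φ.flow r z)) P → (∀ z ∈ Φ.good, 0 ≤ ∫ r in s..(s + τ), Tl r (Φ.flow r z)) → (∫ z, (∫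 r in s..(s + τ), Tl r (Φ.flow r z)) ∂P) ≤ τ * C₂ → (∫ r in s..(s + τ), (mst r - ∫ z, X r (Φ.flow r z) ∂P)) - τ * (mst s - ∫ z, X s (Φ.flow s z) ∂P) ≤ CE * τ ^ 2 + 2 * d + C₁ * τ * (τ * (1 + ∫ z, kineticPP z ∂P) + τ * C₂) + 2 * CX * τ * (∫ z in G'ᶜ, (1 + kineticPP z) ∂P) := by
  intro ε n Φ P _ hP s τ hτ X mst Tl wM wE G' hG' C₁ C₂ CX CE d hC₁ _hC₂ _hCX hCE hd hpath hXb hmst hmstE _hTl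
    hXint hKint hJint hFub hmint hITint hITnn hITle
  have hle : s ≤ s + τ := le_add_of_nonneg_right hτ.le
  -- good points are `P`-almost all points
  have hgood : ∀ᵐ z ∂P, z ∈ Φ.good := hP.ae_le Φ.ae_mem_good
  have hK : ∀ w : Config n (Fin 3) T3, 0 ≤ kineticPP w := fun w => by
    unfold kineticPP
    positivity
  -- crude bounds along good orbits (`K` is conserved)
  have hJb : ∀ z ∈ Φ.good, |∫ r in s..(s + τ), X r (Φ.flow r z)| ≤ τ * (CX * (1 + kineticPP z)) := by
    intro z hz
    refine xp_abs_intervalIntegral_le hτ.le fun r hr => ?_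
    exact (hXb r hr _).trans_eq (by rw [wc_kineticPP_flow Φ hz r])
  have hXs : ∀ z ∈ Φ.good, |X s (Φ.flow s z)| ≤ CX * (1 + kineticPP z) := fun z hz =>
    (hXb s ⟨le_rfl, hle⟩ _).trans_eq (by rw [wc_kineticPP_flow Φ hz s])
  -- the two brackets
  have h1 := xp_time_bracket hτ.le hmst hmstE hCE
  have h2 := xp_expect_bracket (P := P) (good := Φ.good) (J := fun z => ∫ r in s..(s + τ), X r (Φ.flow r z))
    (Xs := fun z => X s (Φ.flow s z)) (K := fun z => kineticPP z) (IT := fun z => ∫ r in s..(s + τ), Tl r (Φ.flow r z))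
    hgood hG' hτ.le hC₁ hd hpath hJb hXs hK hITnn hJint (hXint s ⟨le_rfl, hle⟩) hKint hITint hITle
  have e : (∫ r in s..(s + τ), (mst r - ∫ z, X r (Φ.flow r z) ∂P)) =
      (∫ r in s..(s + τ), mst r) - ∫ r in s..(s + τ), ∫ z, X r (Φ.flow r z) ∂P :=
    intervalIntegral.integral_sub (hmst.intervalIntegrable_of_Icc hle) hmint
  rw [← hFub] at e
  linarith

end Summit.AtomisticToContinuum.HydrodynamicLimit.Theorems.NearConstantShortTimeHL

end
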